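import Mathlib.MeasureTheory.Integral.Prod
import Mathlib.Analysis.SpecialFunctions.Integrals.Basic
import Literature.NumberTheory.Sieve.AsymptoticSieveForPrimesDecomposition
import HarnessLib

/-!
# Asymptotic sieve for primes: assembly of Theorem 1 from the term estimates

Trunk T-SIEVE. Source: J. Friedlander, H. Iwaniec, *Asymptotic sieve for primes*, Ann. of Math. 148
(1998) 1041–1065 [FriedlanderIwaniecASP1998] (= arXiv:math/9811186), §3 (the smoothing operator
`I_h(Y, Z)`, (3.4), (3.5), pp. 1051–1052) and the last line of §8 (p. 1058): "Combining (3.4), (3.5),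
(4.5), (5.1), (6.6), (7.2) and (8.5) we complete the proof of Theorem 1."

This file PROVES that combination: the named facts of
`Literature.NumberTheory.Sieve.AsymptoticSieveForPrimesDecomposition` (the five term estimates
(4.5), (5.1), (6.6), (7.2), (8.5), the sieve-density class of §6 and `H > 0`) together with Brun's
sieve (`brun_upperSieveWeights`, `…Inputs`) imply `Literature.NumberTheory.Sieve.fi_asymptotic_sieve_primes_loglog`
(FI Theorem 1 in the regime `δ = (log x)^α`, `Δ = x^θ`, `0 < θ < 1/3`). Everything in this file is
a theorem; no statement of the tree is modified.

## Contents

* `abs_logAvg_le_of_decomposition`: the smoothing step abstractly — if on `[Y, eY] × [Z, eZ]`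
  `Φ(z) = T₁(y) - T₂(y,z) + P₁(y,z) + P₂(y,z) + P₃(y,z)` with `|T₁| ≤ E₁`, `|T₂| ≤ E₂`, `|P₁| ≤ E₃`,
  `|∫_Y^{eY} P₂ dy/y| ≤ E₄` (each `z`), `|∫_Z^{eZ} P₃ dz/z| ≤ E₅` (each `y`), then
  `|∫_Z^{eZ} Φ dz/z| ≤ (e-1)²(E₁+E₂+E₃) + (e-1)(E₄+E₅)` (uses `∫_Y^{eY} dy/y = 1` and Fubini,
  `MeasureTheory.intervalIntegral_intervalIntegral_swap`, for `P₂`);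
* measurability in `(y, z)` and boundedness of `S₂(x; y, z)`, `S₃(x; y, z)` (finite sums of step
  functions), monotonicity of `S♯(x, z)` in `z`, integrability of `S♯(x, z)/z`, and the sandwich
  `S♯(x, eZ) ≤ S(x, Z) ≤ S♯(x, Z)` (FI (3.5));
* the parameter bookkeeping for large `x`: `exists_isFISplit` (a power of `2` in
  `(fiSLow, 2 fiSLow]`), `fiY_pos_and_ge` (`Y > 0`, `Y ≥ x^{θ₁}` from (R1)), `fiSLow_ge`,
  `eventually_exp_mul_fiY_le_sqrt` (`eY ≤ √x`);
* **`fi_asymptotic_sieve_primes_loglog_of_estimates`**: the assembly. Given the hypotheses of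
  `fi_asymptotic_sieve_primes_loglog`, take `κ, A₁, A₂` from `fi_sieve_density_admissible`, Brun's
  weights of sifting range `z = x^{θ₁}` and level `z^c` from `brun_upperSieveWeights`
  (`θ₁ = θ/(2 max(c,1))`, so the level is `≤ x^{θ/2}`), obtaining an `FIRegime`; the sieve bound of
  §6 for `w_ε` follows; the five estimates give constants `K`; for large `x` choose `s`
  (`exists_isFISplit`), decompose `S♯(x, z) - HA(x)` by (3.4)
  (`FIAsymptoticSieveHypotheses.fiTail_eq_decomposition`), average over `[Y, eY]²`
  (`abs_logAvg_le_of_decomposition`), pass from `∑_{p ≤ x} a_p log p` to `S(x, Y)` by the sandwich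
  and `FIAsymptoticSieveHypotheses.isBigO_sum_primes_sub_tail` (`eY ≤ √x`), and absorb
  `A/log x`, `A/(log x)²` into `A log log x / log x`; finally `H > 0` (`fi_densityConstant_pos`)
  converts the bound into `O(H A(x) log log x / log x)`.

## Faithfulness notes

* This is a proof, not a restatement: the target `fi_asymptotic_sieve_primes_loglog` is the tree's
  (accepted) corrected form of FI Theorem 1; the eight hypotheses are the tree's named facts, cited
  at their definitions. The constants `(e - 1)²`, `(e - 1)` replace FI's exact averaging (their
  operator has total mass `1`); only the `O`-constant is affected.

## Mathlib search

Used: `intervalIntegral` (`integral_inv`, `integral_const_mul`, `integral_sub`, `integral_mono_on`,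
`norm_integral_le_of_norm_le_const`, `AntitoneOn.intervalIntegrable`,
`IntervalIntegrable.mul_continuousOn`, `intervalIntegrable_inv`),
`MeasureTheory.intervalIntegral_intervalIntegral_swap`, `IntegrableOn.of_bound`,
`Integrable.integral_prod_left`, `Measure.prod_restrict`, `Measurable.ite`, `Finset.measurable_sum`,
`exists_nat_pow_near`, `isLittleO_log_rpow_rpow_atTop`, `tendsto_rpow_atTop`,
`Asymptotics.IsBigO.bound`/`of_bound`. Nothing of the kind exists for sieves in Mathlib.
-/

noncomputable section

open Filter Asymptotics Finset MeasureTheory Set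
open scoped ArithmeticFunction.Moebius ArithmeticFunction.vonMangoldt ArithmeticFunction.zeta
  ArithmeticFunction.Omega Interval

namespace Literature.NumberTheory.Sieve

/-! ### An abstract averaging lemma (the smoothing step of FI §3) -/

section Averaging

/-- `∫_Y^{eY} dy/y = 1` for `Y > 0`. [folklore] -/
theorem integral_inv_Ioc_exp_mul {Y : ℝ} (hY : 0 < Y) :
    ∫ y in Y..(Real.exp 1 * Y), y⁻¹ = 1 := by
  have he : 0 < Real.exp 1 := Real.exp_pos 1
  rw [integral_inv (Set.notMem_uIcc_of_lt hY (by positivity)), mul_div_assoc, div_self hY.ne',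
    mul_one, Real.log_exp]

/-- A bounded measurable function of two variables is integrable on a bounded rectangle
`(a, b] × (c, d]`. [folklore] -/
theorem integrableOn_uIoc_prod_of_bound {F : ℝ → ℝ → ℝ} (hF : Measurable (Function.uncurry F))
    {a b c d B : ℝ} (hab : a ≤ b) (hcd : c ≤ d)
    (hB : ∀ y ∈ Ioc a b, ∀ z ∈ Ioc c d, |F y z| ≤ B) :
    IntegrableOn (Function.uncurry F) (Ι a b ×ˢ Ι c d) volume := by
  rw [Set.uIoc_of_le hab, Set.uIoc_of_le hcd]
  refine IntegrableOn.of_bound ?_ hF.aestronglyMeasurable B ?_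
  · refine lt_of_le_of_lt (measure_mono (Set.prod_mono Set.Ioc_subset_Icc_self Set.Ioc_subset_Icc_self)) ?_
    exact (isCompact_Icc.prod isCompact_Icc).measure_lt_top
  · refine ae_restrict_of_forall_mem (measurableSet_Ioc.prod measurableSet_Ioc) ?_
    rintro ⟨y, z⟩ ⟨hy, hz⟩
    simpa [Real.norm_eq_abs] using hB y hy z hz

/-- **The smoothing step of FI §3, abstractly.** Suppose that on the rectangle
`[Y, eY] × [Z, eZ]` (`Y, Z > 0`) a function `Φ(z)` decomposes as
`Φ(z) = T₁(y) - T₂(y, z) + P₁(y, z) + P₂(y, z) + P₃(y, z)` with `|T₁| ≤ E₁`, `|T₂| ≤ E₂`, `|P₁| ≤ E₃`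
pointwise, `|∫_Y^{eY} P₂(y, z) dy/y| ≤ E₄` for each `z` and `|∫_Z^{eZ} P₃(y, z) dz/z| ≤ E₅` for each
`y` (`P₂, P₃` measurable and bounded, `Φ` integrable). Then
`|∫_Z^{eZ} Φ(z) dz/z| ≤ (e-1)²(E₁ + E₂ + E₃) + (e-1)(E₄ + E₅)`: integrate the identity against
`dy dz/(yz)` (FI's operator `I_h(Y, Z)`), using `∫_Y^{eY} dy/y = 1` and Fubini for `P₂`.
[cite: FriedlanderIwaniecASP1998, §3 pp. 1051-1052] -/
theorem abs_logAvg_le_of_decomposition {Y Z E₁ E₂ E₃ E₄ E₅ B : ℝ} (hY : 0 < Y) (hZ : 0 < Z)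
    {Φ T₁ : ℝ → ℝ} {T₂ P₁ P₂ P₃ : ℝ → ℝ → ℝ}
    (hΦ : IntervalIntegrable (fun z => Φ z / z) volume Z (Real.exp 1 * Z))
    (hP₂m : Measurable (Function.uncurry P₂)) (hP₃m : Measurable (Function.uncurry P₃))
    (hP₂b : ∀ y ∈ Icc Y (Real.exp 1 * Y), ∀ z ∈ Icc Z (Real.exp 1 * Z), |P₂ y z| ≤ B)
    (hP₃b : ∀ y ∈ Icc Y (Real.exp 1 * Y), ∀ z ∈ Icc Z (Real.exp 1 * Z), |P₃ y z| ≤ B)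
    (hid : ∀ y ∈ Icc Y (Real.exp 1 * Y), ∀ z ∈ Icc Z (Real.exp 1 * Z),
      Φ z = T₁ y - T₂ y z + P₁ y z + P₂ y z + P₃ y z)
    (h₁ : ∀ y ∈ Icc Y (Real.exp 1 * Y), |T₁ y| ≤ E₁)
    (h₂ : ∀ y ∈ Icc Y (Real.exp 1 * Y), ∀ z ∈ Icc Z (Real.exp 1 * Z), |T₂ y z| ≤ E₂)
    (h₃ : ∀ y ∈ Icc Y (Real.exp 1 * Y), ∀ z ∈ Icc Z (Real.exp 1 * Z), |P₁ y z| ≤ E₃)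
    (h₄ : ∀ z ∈ Icc Z (Real.exp 1 * Z), |∫ y in Y..(Real.exp 1 * Y), P₂ y z / y| ≤ E₄)
    (h₅ : ∀ y ∈ Icc Y (Real.exp 1 * Y), |∫ z in Z..(Real.exp 1 * Z), P₃ y z / z| ≤ E₅) :
    |∫ z in Z..(Real.exp 1 * Z), Φ z / z| ≤
      (Real.exp 1 - 1) ^ 2 * (E₁ + E₂ + E₃) + (Real.exp 1 - 1) * (E₄ + E₅) := by
  set e := Real.exp 1 with he_def
  have he1 : 1 < e := by have := Real.exp_one_gt_d9; linarith
  have he0 : 0 < e - 1 := by linarith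
  have hYe : Y ≤ e * Y := by nlinarith
  have hZe : Z ≤ e * Z := by nlinarith
  have hYe' : Y < e * Y := by nlinarith
  have hZe' : Z < e * Z := by nlinarith
  -- nonnegativity of the bounds (from the hypotheses at the corner `(Y, Z)`)
  have hYmem : Y ∈ Icc Y (e * Y) := ⟨le_rfl, hYe⟩
  have hZmem : Z ∈ Icc Z (e * Z) := ⟨le_rfl, hZe⟩
  have hE₁ : 0 ≤ E₁ := (abs_nonneg _).trans (h₁ Y hYmem)
  have hE₂ : 0 ≤ E₂ := (abs_nonneg _).trans (h₂ Y hYmem Z hZmem)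
  have hE₃ : 0 ≤ E₃ := (abs_nonneg _).trans (h₃ Y hYmem Z hZmem)
  have hE₄ : 0 ≤ E₄ := (abs_nonneg _).trans (h₄ Z hZmem)
  have hE₅ : 0 ≤ E₅ := (abs_nonneg _).trans (h₅ Y hYmem)
  have hB : 0 ≤ B := (abs_nonneg _).trans (hP₂b Y hYmem Z hZmem)
  -- the two kernels `F₂(y,z) = P₂(y,z)/z/y`, `F₃(y,z) = P₃(y,z)/z/y` are integrable on the rectangle
  have hF₂m : Measurable (Function.uncurry fun y z => P₂ y z / z / y) :=
    (hP₂m.div measurable_snd).div measurable_fst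
  have hF₃m : Measurable (Function.uncurry fun y z => P₃ y z / z / y) :=
    (hP₃m.div measurable_snd).div measurable_fst
  have hbound : ∀ (P : ℝ → ℝ → ℝ),
      (∀ y ∈ Icc Y (e * Y), ∀ z ∈ Icc Z (e * Z), |P y z| ≤ B) →
      ∀ y ∈ Ioc Y (e * Y), ∀ z ∈ Ioc Z (e * Z), |P y z / z / y| ≤ B / Z / Y := by
    intro P hP y hy z hz
    have hy0 : 0 < y := hY.trans hy.1
    have hz0 : 0 < z := hZ.trans hz.1
    rw [abs_div, abs_div, abs_of_pos hz0, abs_of_pos hy0]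
    have h1 := hP y (Ioc_subset_Icc_self hy) z (Ioc_subset_Icc_self hz)
    calc |P y z| / z / y ≤ B / z / y := by gcongr
      _ ≤ B / Z / y := by gcongr; exact hz.1.le
      _ ≤ B / Z / Y := by gcongr; exact hy.1.le
  have hI₂ : IntegrableOn (Function.uncurry fun y z => P₂ y z / z / y) (Ι Y (e * Y) ×ˢ Ι Z (e * Z))
      volume := integrableOn_uIoc_prod_of_bound hF₂m hYe hZe (hbound P₂ hP₂b)
  have hI₃ : IntegrableOn (Function.uncurry fun y z => P₃ y z / z / y) (Ι Y (e * Y) ×ˢ Ι Z (e * Z))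
      volume := integrableOn_uIoc_prod_of_bound hF₃m hYe hZe (hbound P₃ hP₃b)
  -- one-variable integrability of the kernels in `z` for fixed `y ∈ Icc`, and of their
  -- `z`-integrals in `y`
  have hprod : ∀ {F : ℝ → ℝ → ℝ}, IntegrableOn (Function.uncurry F) (Ι Y (e * Y) ×ˢ Ι Z (e * Z)) volume →
      Integrable (Function.uncurry F)
        ((volume.restrict (Ioc Y (e * Y))).prod (volume.restrict (Ioc Z (e * Z)))) := by
    intro F hF
    rw [Measure.prod_restrict, ← Measure.volume_eq_prod]
    simpa [Set.uIoc_of_le hYe, Set.uIoc_of_le hZe, IntegrableOn] using hF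
  have houter : ∀ {F : ℝ → ℝ → ℝ}, IntegrableOn (Function.uncurry F) (Ι Y (e * Y) ×ˢ Ι Z (e * Z)) volume →
      IntervalIntegrable (fun y => ∫ z in Z..(e * Z), F y z) volume Y (e * Y) := by
    intro F hF
    have h := (hprod hF).integral_prod_left
    rw [intervalIntegrable_iff, Set.uIoc_of_le hYe]
    refine (integrableOn_congr_fun (fun y _ => ?_) measurableSet_Ioc).mpr h
    simp [intervalIntegral.integral_of_le hZe, Function.uncurry]
  -- `z`-integrability of `z ↦ P y z / z` for fixed `y`
  have hinner : ∀ {P : ℝ → ℝ → ℝ}, Measurable (Function.uncurry P) →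
      (∀ y ∈ Icc Y (e * Y), ∀ z ∈ Icc Z (e * Z), |P y z| ≤ B) →
      ∀ y ∈ Icc Y (e * Y), IntervalIntegrable (fun z => P y z / z) volume Z (e * Z) := by
    intro P hPm hPb y hy
    rw [intervalIntegrable_iff, Set.uIoc_of_le hZe]
    have hm : Measurable fun z => P y z / z := (hPm.of_uncurry_left (x := y)).div measurable_id
    refine IntegrableOn.of_bound measure_Ioc_lt_top hm.aestronglyMeasurable (B / Z) ?_
    refine ae_restrict_of_forall_mem measurableSet_Ioc fun z hz => ?_
    have hz0 : 0 < z := hZ.trans hz.1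
    rw [Real.norm_eq_abs, abs_div, abs_of_pos hz0]
    calc |P y z| / z ≤ B / z := by gcongr; exact hPb y hy z (Ioc_subset_Icc_self hz)
      _ ≤ B / Z := by gcongr; exact hz.1.le
  -- names
  set L : ℝ := ∫ z in Z..(e * Z), Φ z / z with hL
  set I₂ : ℝ → ℝ := fun y => ∫ z in Z..(e * Z), P₂ y z / z with hI₂def
  set I₃ : ℝ → ℝ := fun y => ∫ z in Z..(e * Z), P₃ y z / z with hI₃def
  -- Step A: for each `y`, `|L - I₂ y - I₃ y| ≤ (e - 1)(E₁ + E₂ + E₃)`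
  have hA : ∀ y ∈ Icc Y (e * Y), |L - I₂ y - I₃ y| ≤ (e - 1) * (E₁ + E₂ + E₃) := by
    intro y hy
    have hg := hinner hP₂m hP₂b y hy
    have hh := hinner hP₃m hP₃b y hy
    have hsub : ∫ z in Z..(e * Z), (Φ z / z - P₂ y z / z - P₃ y z / z) = L - I₂ y - I₃ y := by
      rw [intervalIntegral.integral_sub (hΦ.sub hg) hh, intervalIntegral.integral_sub hΦ hg]
    rw [← hsub]
    have hbd : ∀ z ∈ Ι Z (e * Z), ‖Φ z / z - P₂ y z / z - P₃ y z / z‖ ≤ (E₁ + E₂ + E₃) / Z := by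
      intro z hz
      rw [Set.uIoc_of_le hZe] at hz
      have hz' : z ∈ Icc Z (e * Z) := Ioc_subset_Icc_self hz
      have hz0 : 0 < z := hZ.trans hz.1
      have hrew : Φ z / z - P₂ y z / z - P₃ y z / z = (T₁ y - T₂ y z + P₁ y z) / z := by
        rw [hid y hy z hz']; ring
      rw [hrew, Real.norm_eq_abs, abs_div, abs_of_pos hz0]
      calc |T₁ y - T₂ y z + P₁ y z| / z ≤ (E₁ + E₂ + E₃) / z := by
            gcongr
            calc |T₁ y - T₂ y z + P₁ y z| ≤ |T₁ y| + |T₂ y z| + |P₁ y z| := by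
                  refine (abs_add_le _ _).trans ?_
                  gcongr
                  exact abs_sub _ _
              _ ≤ E₁ + E₂ + E₃ := by
                  gcongr
                  exacts [h₁ y hy, h₂ y hy z hz', h₃ y hy z hz']
        _ ≤ (E₁ + E₂ + E₃) / Z := div_le_div_of_nonneg_left (by linarith) hZ hz.1.le
    have := intervalIntegral.norm_integral_le_of_norm_le_const hbd
    rw [Real.norm_eq_abs] at this
    refine this.trans (le_of_eq ?_)
    rw [show e * Z - Z = (e - 1) * Z by ring, abs_of_pos (by positivity)]
    field_simp
  -- Step B: integrate over `y` against `dy/y`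
  have hLy : ∫ y in Y..(e * Y), L / y = L := by
    simp_rw [div_eq_mul_inv]
    rw [intervalIntegral.integral_const_mul, integral_inv_Ioc_exp_mul hY, mul_one]
  -- integrability in `y`
  have hinvY : IntervalIntegrable (fun y : ℝ => y⁻¹) volume Y (e * Y) := by
    refine intervalIntegral.intervalIntegrable_inv (fun y hy => ?_) continuousOn_id
    rw [Set.uIcc_of_le hYe] at hy
    exact (hY.trans_le hy.1).ne'
  have hIy : ∀ {P : ℝ → ℝ → ℝ}, IntegrableOn (Function.uncurry fun y z => P y z / z / y)
      (Ι Y (e * Y) ×ˢ Ι Z (e * Z)) volume →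
      IntervalIntegrable (fun y => (∫ z in Z..(e * Z), P y z / z) / y) volume Y (e * Y) := by
    intro P hP
    have h := houter hP
    refine (intervalIntegrable_congr fun y _ => ?_).mp h
    simp only [intervalIntegral.integral_div]
  have hI₂y : IntervalIntegrable (fun y => I₂ y / y) volume Y (e * Y) := hIy hI₂
  have hI₃y : IntervalIntegrable (fun y => I₃ y / y) volume Y (e * Y) := hIy hI₃
  have hLyI : IntervalIntegrable (fun y => L / y) volume Y (e * Y) := by
    simpa [div_eq_mul_inv] using hinvY.const_mul L
  have hsplit : ∫ y in Y..(e * Y), L / y =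
      (∫ y in Y..(e * Y), (L - I₂ y - I₃ y) / y) + (∫ y in Y..(e * Y), I₂ y / y)
        + ∫ y in Y..(e * Y), I₃ y / y := by
    have h1 : IntervalIntegrable (fun y => (L - I₂ y - I₃ y) / y) volume Y (e * Y) := by
      have : (fun y => (L - I₂ y - I₃ y) / y) = fun y => L / y - I₂ y / y - I₃ y / y := by
        funext y; ring
      rw [this]
      exact (hLyI.sub hI₂y).sub hI₃y
    rw [← intervalIntegral.integral_add h1 hI₂y, ← intervalIntegral.integral_add (h1.add hI₂y) hI₃y]
    refine intervalIntegral.integral_congr fun y _ => ?_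
    ring
  -- the three bounds
  have hB1 : |∫ y in Y..(e * Y), (L - I₂ y - I₃ y) / y| ≤ (e - 1) ^ 2 * (E₁ + E₂ + E₃) := by
    have hbd : ∀ y ∈ Ι Y (e * Y), ‖(L - I₂ y - I₃ y) / y‖ ≤ (e - 1) * (E₁ + E₂ + E₃) / Y := by
      intro y hy
      rw [Set.uIoc_of_le hYe] at hy
      have hy0 : 0 < y := hY.trans hy.1
      rw [Real.norm_eq_abs, abs_div, abs_of_pos hy0]
      calc |L - I₂ y - I₃ y| / y ≤ (e - 1) * (E₁ + E₂ + E₃) / y := by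
            gcongr; exact hA y (Ioc_subset_Icc_self hy)
        _ ≤ (e - 1) * (E₁ + E₂ + E₃) / Y :=
            div_le_div_of_nonneg_left (mul_nonneg he0.le (by linarith)) hY hy.1.le
    have := intervalIntegral.norm_integral_le_of_norm_le_const hbd
    rw [Real.norm_eq_abs] at this
    refine this.trans (le_of_eq ?_)
    rw [show e * Y - Y = (e - 1) * Y by ring, abs_of_pos (by positivity)]
    field_simp
  have hB3 : |∫ y in Y..(e * Y), I₃ y / y| ≤ (e - 1) * E₅ := by
    have hbd : ∀ y ∈ Ι Y (e * Y), ‖I₃ y / y‖ ≤ E₅ / Y := by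
      intro y hy
      rw [Set.uIoc_of_le hYe] at hy
      have hy0 : 0 < y := hY.trans hy.1
      rw [Real.norm_eq_abs, abs_div, abs_of_pos hy0]
      calc |I₃ y| / y ≤ E₅ / y := by gcongr; exact h₅ y (Ioc_subset_Icc_self hy)
        _ ≤ E₅ / Y := by gcongr; exact hy.1.le
    have := intervalIntegral.norm_integral_le_of_norm_le_const hbd
    rw [Real.norm_eq_abs] at this
    refine this.trans (le_of_eq ?_)
    rw [show e * Y - Y = (e - 1) * Y by ring, abs_of_pos (by positivity)]
    field_simp
  have hB2 : |∫ y in Y..(e * Y), I₂ y / y| ≤ (e - 1) * E₄ := by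
    -- Fubini
    have hswap : ∫ y in Y..(e * Y), I₂ y / y =
        ∫ z in Z..(e * Z), (∫ y in Y..(e * Y), P₂ y z / y) / z := by
      have h1 : (fun y => I₂ y / y) = fun y => ∫ z in Z..(e * Z), P₂ y z / z / y := by
        funext y; rw [intervalIntegral.integral_div]
      rw [h1, intervalIntegral_intervalIntegral_swap hI₂]
      refine intervalIntegral.integral_congr fun z _ => ?_
      rw [← intervalIntegral.integral_div]
      refine intervalIntegral.integral_congr fun y _ => ?_
      rw [div_right_comm]
    rw [hswap]
    have hbd : ∀ z ∈ Ι Z (e * Z), ‖(∫ y in Y..(e * Y), P₂ y z / y) / z‖ ≤ E₄ / Z := by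
      intro z hz
      rw [Set.uIoc_of_le hZe] at hz
      have hz0 : 0 < z := hZ.trans hz.1
      rw [Real.norm_eq_abs, abs_div, abs_of_pos hz0]
      calc |∫ y in Y..(e * Y), P₂ y z / y| / z ≤ E₄ / z := by
            gcongr; exact h₄ z (Ioc_subset_Icc_self hz)
        _ ≤ E₄ / Z := by gcongr; exact hz.1.le
    have := intervalIntegral.norm_integral_le_of_norm_le_const hbd
    rw [Real.norm_eq_abs] at this
    refine this.trans (le_of_eq ?_)
    rw [show e * Z - Z = (e - 1) * Z by ring, abs_of_pos (by positivity)]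
    field_simp
  -- conclusion
  rw [← hLy, hsplit]
  calc |(∫ y in Y..(e * Y), (L - I₂ y - I₃ y) / y) + (∫ y in Y..(e * Y), I₂ y / y)
          + ∫ y in Y..(e * Y), I₃ y / y|
      ≤ |∫ y in Y..(e * Y), (L - I₂ y - I₃ y) / y| + |∫ y in Y..(e * Y), I₂ y / y|
          + |∫ y in Y..(e * Y), I₃ y / y| := abs_add_three _ _ _
    _ ≤ (e - 1) ^ 2 * (E₁ + E₂ + E₃) + (e - 1) * E₄ + (e - 1) * E₅ := by gcongr
    _ = (e - 1) ^ 2 * (E₁ + E₂ + E₃) + (e - 1) * (E₄ + E₅) := by ring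

end Averaging

/-! ### Measurability and boundedness of the sums `S₂`, `S₃` in `(y, z)` -/

section Measurability

variable {β : Type*} [MeasurableSpace β]

/-- `p ↦ f(n ≤ u(p))` is measurable in the parameter. [folklore] -/
theorem measurable_truncLE_apply (f : ArithmeticFunction ℝ) {u : β → ℝ} (hu : Measurable u) (n : ℕ) :
    Measurable fun p => truncLE f (u p) n := by
  simp only [truncLE_apply]
  exact Measurable.ite (measurableSet_le measurable_const hu) measurable_const measurable_const

/-- `p ↦ f(n > u(p))` is measurable in the parameter. [folklore] -/
theorem measurable_truncGT_apply (f : ArithmeticFunction ℝ) {u : β → ℝ} (hu : Measurable u) (n : ℕ) :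
    Measurable fun p => truncGT f (u p) n := by
  simp only [truncGT_apply]
  exact Measurable.ite (measurableSet_lt hu measurable_const) measurable_const measurable_const

/-- `p ↦ f(v(p) ≥ n > u(p))` is measurable in the parameters. [folklore] -/
theorem measurable_truncIoc_apply (f : ArithmeticFunction ℝ) {u v : β → ℝ} (hu : Measurable u)
    (hv : Measurable v) (n : ℕ) : Measurable fun p => truncIoc f (u p) (v p) n := by
  simp only [truncIoc_apply]
  refine Measurable.ite ?_ measurable_const measurable_const
  exact (measurableSet_lt hu measurable_const).inter (measurableSet_le measurable_const hv)

/-- Measurability of `p ↦ (F_p * G_p * ζ)(n)` from that of the coefficients. [folklore] -/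
theorem measurable_mul_mul_zeta_apply {F G : β → ArithmeticFunction ℝ}
    (hF : ∀ m, Measurable fun p => F p m) (hG : ∀ m, Measurable fun p => G p m) (n : ℕ) :
    Measurable fun p => (F p * G p * ζ) n := by
  simp only [ArithmeticFunction.mul_apply, ArithmeticFunction.natCoe_apply]
  refine Finset.measurable_sum _ fun x _ => ?_
  refine Measurable.mul ?_ measurable_const
  exact Finset.measurable_sum _ fun y _ => (hF _).mul (hG _)

/-- Measurability of `p ↦ ∑_{n ≤ x} a_n ρ_n F_p(n)` from that of `p ↦ F_p(n)`. [folklore] -/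
theorem SieveSequence.measurable_rhoSum (A : SieveSequence) (lam : ℕ → ℤ) (x : ℝ)
    {F : β → ArithmeticFunction ℝ} (hF : ∀ n, Measurable fun p => F p n) :
    Measurable fun p => A.rhoSum lam (F p) x :=
  Finset.measurable_sum _ fun n _ => (hF n).const_mul _

/-- `(y, z) ↦ S₂(x; y, z)` is (jointly) measurable. [folklore] -/
theorem SieveSequence.measurable_fiS2 (A : SieveSequence) (lam : ℕ → ℤ) (s x : ℝ) :
    Measurable (Function.uncurry fun y z => A.fiS2 lam s x y z) := by
  change Measurable fun p : ℝ × ℝ => A.fiS2 lam s x p.1 p.2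
  simp only [SieveSequence.fiS2]
  refine A.measurable_rhoSum lam x (measurable_mul_mul_zeta_apply (fun m => ?_) (fun m => ?_))
  · exact measurable_truncIoc_apply _ measurable_fst (measurable_fst.const_mul s) m
  · exact measurable_truncGT_apply _ measurable_snd m

/-- `(y, z) ↦ S₃(x; y, z)` is (jointly) measurable. [folklore] -/
theorem SieveSequence.measurable_fiS3 (A : SieveSequence) (lam : ℕ → ℤ) (s x : ℝ) :
    Measurable (Function.uncurry fun y z => A.fiS3 lam s x y z) := by
  change Measurable fun p : ℝ × ℝ => A.fiS3 lam s x p.1 p.2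
  simp only [SieveSequence.fiS3]
  refine A.measurable_rhoSum lam x (measurable_mul_mul_zeta_apply (fun m => ?_) (fun m => ?_))
  · exact measurable_truncGT_apply _ (measurable_fst.const_mul s) m
  · exact measurable_truncIoc_apply _ measurable_snd (measurable_snd.const_mul s) m

/-- Crude bound `|(F * G * ζ)(n)| ≤ ∑_{de = n} ∑_{bc = d} Λ(c)` when `|F| ≤ 1` and `|G| ≤ Λ`.
[folklore] -/
theorem abs_mul_mul_zeta_apply_le {F G : ArithmeticFunction ℝ} (hF : ∀ m, |F m| ≤ 1)
    (hG : ∀ m, |G m| ≤ Λ m) (n : ℕ) :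
    |(F * G * ζ) n| ≤ ∑ x ∈ n.divisorsAntidiagonal, ∑ y ∈ x.1.divisorsAntidiagonal, Λ y.2 := by
  simp only [ArithmeticFunction.mul_apply, ArithmeticFunction.natCoe_apply,
    ArithmeticFunction.zeta_apply]
  refine (Finset.abs_sum_le_sum_abs _ _).trans (Finset.sum_le_sum fun x hx => ?_)
  have hx2 : x.2 ≠ 0 := (Nat.mem_divisorsAntidiagonal.mp hx).2 |> fun h h0 => by
    apply h; rw [← (Nat.mem_divisorsAntidiagonal.mp hx).1, h0, mul_zero]
  rw [if_neg hx2, Nat.cast_one, mul_one]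
  refine (Finset.abs_sum_le_sum_abs _ _).trans (Finset.sum_le_sum fun y _ => ?_)
  rw [abs_mul]
  calc |F y.1| * |G y.2| ≤ 1 * Λ y.2 :=
        mul_le_mul (hF _) (hG _) (abs_nonneg _) zero_le_one
    _ = Λ y.2 := one_mul _

/-- Truncations of `μ` are bounded by `1`. [folklore] -/
theorem abs_truncLE_moebius_le (u : ℝ) (m : ℕ) : |truncLE (μ : ArithmeticFunction ℝ) u m| ≤ 1 := by
  simp only [truncLE_apply, ArithmeticFunction.intCoe_apply]
  split_ifs
  · exact_mod_cast ArithmeticFunction.abs_moebius_le_one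
  · simp

/-- Truncations of `μ` are bounded by `1`. [folklore] -/
theorem abs_truncGT_moebius_le (u : ℝ) (m : ℕ) : |truncGT (μ : ArithmeticFunction ℝ) u m| ≤ 1 := by
  simp only [truncGT_apply, ArithmeticFunction.intCoe_apply]
  split_ifs
  · exact_mod_cast ArithmeticFunction.abs_moebius_le_one
  · simp

/-- Truncations of `μ` are bounded by `1`. [folklore] -/
theorem abs_truncIoc_moebius_le (u v : ℝ) (m : ℕ) :
    |truncIoc (μ : ArithmeticFunction ℝ) u v m| ≤ 1 := by
  simp only [truncIoc_apply, ArithmeticFunction.intCoe_apply]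
  split_ifs
  · exact_mod_cast ArithmeticFunction.abs_moebius_le_one
  · simp

/-- Truncations of `Λ` are bounded by `Λ`. [folklore] -/
theorem abs_truncGT_vonMangoldt_le (u : ℝ) (m : ℕ) : |truncGT Λ u m| ≤ Λ m := by
  simp only [truncGT_apply]
  split_ifs
  · exact le_of_eq (abs_of_nonneg ArithmeticFunction.vonMangoldt_nonneg)
  · simp [ArithmeticFunction.vonMangoldt_nonneg]

/-- Truncations of `Λ` are bounded by `Λ`. [folklore] -/
theorem abs_truncIoc_vonMangoldt_le (u v : ℝ) (m : ℕ) : |truncIoc Λ u v m| ≤ Λ m := by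
  simp only [truncIoc_apply]
  split_ifs
  · exact le_of_eq (abs_of_nonneg ArithmeticFunction.vonMangoldt_nonneg)
  · simp [ArithmeticFunction.vonMangoldt_nonneg]

/-- `S₂(x; y, z)` and `S₃(x; y, z)` are bounded uniformly in `s, y, z` (for fixed `x` and weights).
[folklore] -/
theorem SieveSequence.exists_bound_fiS2_fiS3 (A : SieveSequence) (lam : ℕ → ℤ) (x : ℝ) :
    ∃ B : ℝ, ∀ s y z : ℝ, |A.fiS2 lam s x y z| ≤ B ∧ |A.fiS3 lam s x y z| ≤ B := by
  set Bd : ℕ → ℝ := fun n =>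
    ∑ x ∈ n.divisorsAntidiagonal, ∑ y ∈ x.1.divisorsAntidiagonal, Λ y.2 with hBd
  refine ⟨∑ n ∈ Icc 1 ⌊x⌋₊, |A.a n * (sieveRho lam n : ℝ)| * Bd n, fun s y z => ⟨?_, ?_⟩⟩
  all_goals
    simp only [SieveSequence.fiS2, SieveSequence.fiS3, SieveSequence.rhoSum]
    refine (Finset.abs_sum_le_sum_abs _ _).trans (Finset.sum_le_sum fun n _ => ?_)
    rw [abs_mul]
    refine mul_le_mul_of_nonneg_left ?_ (abs_nonneg _)
  · exact abs_mul_mul_zeta_apply_le (abs_truncIoc_moebius_le _ _) (abs_truncGT_vonMangoldt_le _) n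
  · exact abs_mul_mul_zeta_apply_le (abs_truncGT_moebius_le _) (abs_truncIoc_vonMangoldt_le _ _) n

end Measurability

/-! ### The sharp-cutoff sum `S♯(x, z)`: monotonicity and the smoothing sandwich -/

namespace SieveSequence

variable (A : SieveSequence)

/-- `S♯(x, z)` is non-increasing in the cut-off `z`. [folklore] -/
theorem fiTail_antitone (x : ℝ) : Antitone (A.fiTail x) := by
  intro z w hzw
  simp only [fiTail]
  refine Finset.sum_le_sum_of_subset_of_nonneg (Finset.Ioc_subset_Ioc_left (Nat.floor_le_floor hzw))
    fun n _ _ => mul_nonneg (A.a_nonneg n) ArithmeticFunction.vonMangoldt_nonneg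

/-- `S♯(x, z) ≥ 0`. [folklore] -/
theorem fiTail_nonneg (x z : ℝ) : 0 ≤ A.fiTail x z :=
  Finset.sum_nonneg fun n _ => mul_nonneg (A.a_nonneg n) ArithmeticFunction.vonMangoldt_nonneg

/-- `z ↦ S♯(x, z)/z` is integrable on `[Z, eZ]` for `Z > 0` (monotone times continuous).
[folklore] -/
theorem intervalIntegrable_fiTail_div (x : ℝ) {Z W : ℝ} (hZ : 0 < Z) (hW : Z ≤ W) :
    IntervalIntegrable (fun z => A.fiTail x z / z) volume Z W := by
  simp_rw [div_eq_mul_inv]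
  refine ((A.fiTail_antitone x).antitoneOn _).intervalIntegrable.mul_continuousOn ?_
  refine continuousOn_inv₀.mono fun z hz => ?_
  rw [Set.uIcc_of_le hW] at hz
  exact (hZ.trans_le hz.1).ne'

/-- The smoothing sandwich: `S♯(x, eZ) ≤ S(x, Z) ≤ S♯(x, Z)` for `Z > 0`
(FI (3.5): `0 ≤ S(x) - S(x; Z) ≤ ∑_{p ≤ eZ} a_p log p`). [cite: FriedlanderIwaniecASP1998, §3 (3.5)] -/
theorem fiTail_le_fiSmooth_le {x Z : ℝ} (hZ : 0 < Z) :
    A.fiTail x (Real.exp 1 * Z) ≤ A.fiSmooth x Z ∧ A.fiSmooth x Z ≤ A.fiTail x Z := by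
  have he1 : 1 < Real.exp 1 := by have := Real.exp_one_gt_d9; linarith
  have hZe : Z ≤ Real.exp 1 * Z := by nlinarith
  have hint := A.intervalIntegrable_fiTail_div x hZ hZe
  have hone := integral_inv_Ioc_exp_mul hZ
  have hcst : ∀ c : ℝ, ∫ z in Z..(Real.exp 1 * Z), c / z = c := fun c => by
    simp_rw [div_eq_mul_inv]
    rw [intervalIntegral.integral_const_mul, hone, mul_one]
  have hinv : IntervalIntegrable (fun z : ℝ => z⁻¹) volume Z (Real.exp 1 * Z) := by
    refine intervalIntegral.intervalIntegrable_inv (fun z hz => ?_) continuousOn_id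
    rw [Set.uIcc_of_le hZe] at hz
    exact (hZ.trans_le hz.1).ne'
  have hcI : ∀ c : ℝ, IntervalIntegrable (fun z : ℝ => c / z) volume Z (Real.exp 1 * Z) := fun c => by
    simpa [div_eq_mul_inv] using hinv.const_mul c
  unfold fiSmooth logAvg
  constructor
  · rw [← hcst (A.fiTail x (Real.exp 1 * Z))]
    refine intervalIntegral.integral_mono_on hZe (hcI _) hint fun z hz => ?_
    have hz0 : 0 < z := hZ.trans_le hz.1
    exact div_le_div_of_nonneg_right (A.fiTail_antitone x hz.2) hz0.le
  · rw [← hcst (A.fiTail x Z)]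
    refine intervalIntegral.integral_mono_on hZe hint (hcI _) fun z hz => ?_
    have hz0 : 0 < z := hZ.trans_le hz.1
    exact div_le_div_of_nonneg_right (A.fiTail_antitone x hz.1) hz0.le

/-- `S♯(x, 0) = ∑_{p ≤ x} a_p log p` under (1.16). [cite: FriedlanderIwaniecASP1998, (1.16)] -/
theorem FIAsymptoticSieveHypotheses.fiTail_zero {A : SieveSequence} {D δ Δ : ℝ → ℝ}
    (h : A.FIAsymptoticSieveHypotheses D δ Δ) (x : ℝ) :
    A.fiTail x 0 = ∑ p ∈ Nat.primesLE ⌊x⌋₊, A.a p * Real.log p := by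
  rw [fiTail, Nat.floor_zero, h.sum_Ioc_a_mul_vonMangoldt]

end SieveSequence

/-! ### Parameters for large `x` -/

section Params

/-- A power of `2` in `(t, 2t]` for `t = fiSLow ≥ 1`: an admissible splitting parameter `s ≥ 1`
exists. [folklore] -/
theorem exists_isFISplit {D : ℝ → ℝ} {α θ x : ℝ} (ht : 1 ≤ fiSLow D α θ x) :
    ∃ s : ℝ, IsFISplit D α θ x s ∧ 1 ≤ s := by
  obtain ⟨n, hn1, hn2⟩ := exists_nat_pow_near ht one_lt_two
  refine ⟨2 ^ (n + 1), ⟨⟨n + 1, rfl⟩, hn2, ?_⟩, one_le_pow₀ (by norm_num)⟩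
  rw [pow_succ]
  linarith

/-- Size of `Y = √D / x^{θ/2}` under (R1): `Y > 0` and `Y ≥ x^{θ₁}` whenever `θ₁ ≤ 1/3 - θ/2`.
[folklore] -/
theorem fiY_pos_and_ge {D : ℝ → ℝ} {θ θ₁ x : ℝ} (hx : 1 ≤ x) (hD : x ^ (2 / 3 : ℝ) < D x)
    (hθ₁ : θ₁ ≤ 1 / 3 - θ / 2) : 0 < fiY D θ x ∧ x ^ θ₁ ≤ fiY D θ x := by
  have hx0 : 0 < x := by linarith
  have h13 : x ^ (1 / 3 : ℝ) < Real.sqrt (D x) := by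
    have : Real.sqrt (x ^ (2 / 3 : ℝ)) < Real.sqrt (D x) := Real.sqrt_lt_sqrt (by positivity) hD
    rwa [Real.sqrt_eq_rpow, ← Real.rpow_mul hx0.le,
      show (2 / 3 : ℝ) * (1 / 2) = 1 / 3 by norm_num] at this
  have hpos : 0 < fiY D θ x := div_pos (lt_trans (by positivity) h13) (by positivity)
  refine ⟨hpos, ?_⟩
  unfold fiY
  rw [le_div_iff₀ (Real.rpow_pos_of_pos hx0 _), ← Real.rpow_add hx0]
  calc x ^ (θ₁ + θ / 2) ≤ x ^ (1 / 3 : ℝ) := Real.rpow_le_rpow_of_exponent_le hx (by linarith)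
    _ ≤ Real.sqrt (D x) := h13.le

/-- Lower bound `fiSLow ≥ x^{θ/2} / (8 (log x)^α)` when `0 < D(x) < x`. [folklore] -/
theorem fiSLow_ge {D : ℝ → ℝ} {α θ x : ℝ} (hx : 1 < x) (hD0 : 0 < D x) (hDx : D x < x) :
    x ^ (θ / 2) / (8 * Real.log x ^ α) ≤ fiSLow D α θ x := by
  unfold fiSLow
  have hlog : 0 < Real.log x := Real.log_pos hx
  have hsD : 0 < Real.sqrt (D x) := Real.sqrt_pos.mpr hD0
  have hsx : Real.sqrt (D x) ≤ Real.sqrt x := Real.sqrt_le_sqrt hDx.le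
  have hlα : 0 < Real.log x ^ α := Real.rpow_pos_of_pos hlog α
  have hx0 : 0 < x := by linarith
  rw [div_le_div_iff₀ (by positivity) (by positivity)]
  have : x ^ (θ / 2) * (8 * Real.log x ^ α * Real.sqrt (D x)) =
      x ^ (θ / 2) * Real.sqrt (D x) * (8 * Real.log x ^ α) := by ring
  rw [this]
  have hxθ : 0 ≤ x ^ (θ / 2) := (Real.rpow_pos_of_pos hx0 _).le
  gcongr

/-- `eY ≤ √x` for large `x` (so that the primes `≤ eZ` are negligible by (1.4)). [folklore] -/
theorem eventually_exp_mul_fiY_le_sqrt {D : ℝ → ℝ} {θ : ℝ} (hθ : 0 < θ)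
    (hR1 : ∀ᶠ x : ℝ in atTop, x ^ (2 / 3 : ℝ) < D x ∧ D x < x) :
    ∀ᶠ x : ℝ in atTop, Real.exp 1 * fiY D θ x ≤ Real.sqrt x := by
  filter_upwards [hR1, (tendsto_rpow_atTop (half_pos hθ)).eventually_ge_atTop (Real.exp 1),
    eventually_gt_atTop 0] with x hx hxe hx0
  unfold fiY
  have hxθ : 0 < x ^ (θ / 2) := Real.rpow_pos_of_pos hx0 _
  rw [mul_div_assoc', div_le_iff₀ hxθ]
  calc Real.exp 1 * Real.sqrt (D x) ≤ Real.exp 1 * Real.sqrt x := by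
        gcongr; exact hx.2.le
    _ ≤ x ^ (θ / 2) * Real.sqrt x := by gcongr
    _ = Real.sqrt x * x ^ (θ / 2) := mul_comm _ _

end Params

/-! ### Assembly -/

set_option maxHeartbeats 800000 in
-- the assembly threads some forty hypotheses through one `filter_upwards`; the default
-- heartbeat budget does not suffice
/-- **Theorem 1 (in the regime `δ = (log x)^α`, `Δ = x^θ`) from its term estimates.** FI p. 1058:
"Combining (3.4), (3.5), (4.5), (5.1), (6.6), (7.2) and (8.5) we complete the proof of Theorem 1."
Precisely: Brun's upper-bound sieve (`brun_upperSieveWeights`) applied to FI's densities `w_ε = g h`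
(`fi_sieve_density_admissible`) provides weights `λ` of sifting range `x^{θ₁}` and level `x^{θ/2}`
satisfying the sieve bound of §6; the five term estimates `fi_asp_T_estimate` (4.5),
`fi_asp_Tyz_estimate` (5.1), `fi_asp_S1_estimate` (6.6), `fi_asp_S2_estimate` (7.2),
`fi_asp_S3_estimate` (8.5), the decomposition (3.4)
(`FIAsymptoticSieveHypotheses.fiTail_eq_decomposition`, proved) integrated against `dy dz/(yz)`
over `[Y, eY]²` (`abs_logAvg_le_of_decomposition`, proved; Fubini for `S₂`), the passage (3.5) from
`∑_{p ≤ x} a_p log p` to `S(x, Z)` (`fiTail_le_fiSmooth_le` and `isBigO_sum_primes_sub_tail`, proved)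
and `H > 0` (`fi_densityConstant_pos`) give `fi_asymptotic_sieve_primes_loglog`.
[cite: FriedlanderIwaniecASP1998, §8 p. 1058 (proof of Theorem 1)] -/
theorem fi_asymptotic_sieve_primes_loglog_of_estimates
    (hBrun : brun_upperSieveWeights) (hdens : fi_sieve_density_admissible)
    (hHpos : fi_densityConstant_pos) (hT : fi_asp_T_estimate) (hTyz : fi_asp_Tyz_estimate)
    (hS1 : fi_asp_S1_estimate) (hS2 : fi_asp_S2_estimate) (hS3 : fi_asp_S3_estimate) :
    fi_asymptotic_sieve_primes_loglog := by
  intro A D α θ H hα hθ hθ3 hhyp hH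
  classical
  -- clauses of the hypotheses
  have h18 := hhyp.2.2.2.1
  have h19 := hhyp.2.2.2.2.1
  have hR1 : ∀ᶠ x : ℝ in atTop, x ^ (2 / 3 : ℝ) < D x ∧ D x < x :=
    hhyp.2.2.2.2.2.2.1.mono fun x hx => ⟨hx.1, hx.2.1⟩
  -- `H > 0`
  have hH0 : 0 < H := hHpos A.density A.density_mult h18 h19 H hH
  -- the sieve-density class and Brun's weights
  obtain ⟨κ, A₁, A₂, hκ, hA₁, hclass⟩ := hdens A.density A.density_mult h18
  obtain ⟨c, C, hc, hC, hw⟩ := hBrun κ A₁ A₂ hκ hA₁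
  set c' : ℝ := max c 1 with hc'def
  have hc'1 : 1 ≤ c' := le_max_right _ _
  have hcc' : c ≤ c' := le_max_left _ _
  have hc'0 : 0 < c' := by linarith
  set θ₁ : ℝ := θ / (2 * c') with hθ₁def
  have hθ₁pos : 0 < θ₁ := by positivity
  have hθ₁c' : θ₁ * c' = θ / 2 := by rw [hθ₁def]; field_simp
  have hθ₁le : θ₁ ≤ θ / 2 := by
    rw [← hθ₁c']; exact le_mul_of_one_le_right hθ₁pos.le hc'1
  have hθ₁c : θ₁ * c ≤ θ / 2 := by
    rw [← hθ₁c']; exact mul_le_mul_of_nonneg_left hcc' hθ₁pos.le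
  have hθ₁13 : θ₁ ≤ 1 / 3 - θ / 2 := by linarith
  -- weights, as a function of `x`
  let lam : ℝ → ℕ → ℤ := fun x =>
    if hx : 2 ≤ x ^ θ₁ then Classical.choose (hw (x ^ θ₁) hx) else fun _ => 0
  have hlam_eq : ∀ (x : ℝ) (hx : 2 ≤ x ^ θ₁), lam x = Classical.choose (hw (x ^ θ₁) hx) :=
    fun x hx => dif_pos hx
  have hspec := fun (x : ℝ) (hx : 2 ≤ x ^ θ₁) => Classical.choose_spec (hw (x ^ θ₁) hx)
  have hev2 : ∀ᶠ x : ℝ in atTop, 2 ≤ x ^ θ₁ := (tendsto_rpow_atTop hθ₁pos).eventually_ge_atTop 2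
  have hweights : ∀ᶠ x : ℝ in atTop, IsUpperSieveWeights (x ^ θ₁) (x ^ (θ / 2)) (lam x) := by
    filter_upwards [hev2, eventually_ge_atTop (1 : ℝ)] with x hx hx1
    rw [hlam_eq x hx]
    refine (hspec x hx).1.mono_level ?_
    rw [← Real.rpow_mul (by linarith)]
    exact Real.rpow_le_rpow_of_exponent_le hx1 hθ₁c
  have hreg : FIRegime A D α θ θ₁ lam := ⟨hα, hθ₁pos, hθ₁le, hθ3, hhyp, hweights⟩
  -- Brun's bound for FI's densities `w_ε`
  have hBB : ∃ C : ℝ, ∀ᶠ x : ℝ in atTop, ∀ ε : ℝ, 0 < ε → ε ≤ 1 →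
      ∑ d ∈ (primesProdBelow (x ^ θ₁)).divisors,
          (lam x d : ℝ) * ∏ p ∈ d.primeFactors, fiSieveDensity A.density ε p ≤
        C * ∏ p ∈ Nat.primesBelow ⌈x ^ θ₁⌉₊, (1 - fiSieveDensity A.density ε p) := by
    refine ⟨C, ?_⟩
    filter_upwards [hev2] with x hx ε hε hε1
    rw [hlam_eq x hx]
    obtain ⟨hw1, hw2⟩ := hclass ε hε hε1
    exact (hspec x hx).2 _ (fun p hp _ => hw1 p hp) (fun u v hu huv _ => hw2 u v hu huv)
  -- the five estimates
  obtain ⟨KT, hKT⟩ := hT A D α θ θ₁ lam H hreg hH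
  obtain ⟨KTyz, hKTyz⟩ := hTyz A D α θ θ₁ lam hreg
  obtain ⟨K1, hK1⟩ := hS1 A D α θ θ₁ lam hreg hBB
  obtain ⟨K2, hK2⟩ := hS2 A D α θ θ₁ lam hreg
  obtain ⟨K3, hK3⟩ := hS3 A D α θ θ₁ lam hreg
  -- the small primes (3.5)
  have hZ' : ∀ᶠ x : ℝ in atTop, Real.exp 1 * fiY D θ x ≤ Real.sqrt x :=
    eventually_exp_mul_fiY_le_sqrt hθ hR1
  have hZ0 : ∀ᶠ x : ℝ in atTop, 0 ≤ Real.exp 1 * fiY D θ x := by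
    filter_upwards [hR1, eventually_ge_atTop (1 : ℝ)] with x hx hx1
    exact mul_nonneg (Real.exp_pos 1).le (fiY_pos_and_ge hx1 hx.1 hθ₁13).1.le
  obtain ⟨K0, hK0⟩ := (hhyp.isBigO_sum_primes_sub_tail hZ0 hZ').bound
  -- growth of `x^{θ/2}` against `(log x)^α`
  have hlog8 : ∀ᶠ x : ℝ in atTop, 8 * Real.log x ^ α ≤ x ^ (θ / 2) := by
    have := (isLittleO_log_rpow_rpow_atTop α (half_pos hθ)).def (by norm_num : (0 : ℝ) < 1 / 8)
    filter_upwards [this, eventually_gt_atTop 1] with x hx hx1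
    rw [Real.norm_of_nonneg (Real.rpow_nonneg (Real.log_nonneg hx1.le) α),
      Real.norm_of_nonneg (Real.rpow_nonneg (by linarith) _)] at hx
    linarith
  -- constants
  set e : ℝ := Real.exp 1 with he_def
  have he1 : 1 < e := by have := Real.exp_one_gt_d9; simp only [he_def]; linarith
  set Ktot : ℝ := |K0| + (e - 1) ^ 2 * (|KT| + |KTyz| + |K1|) + (e - 1) * (|K2| + |K3|) with hKtot
  refine IsBigO.of_bound (Ktot / H) ?_
  filter_upwards [hweights, hKT, hKTyz, hK1, hK2, hK3, hK0, hR1, hlog8,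
    eventually_ge_atTop (Real.exp (Real.exp 1))] with x hwx hTx hTyzx h1x h2x h3x h0x hR1x hlog8x hxee
  -- basic inequalities at `x`
  have hxe : Real.exp 1 ≤ x := le_trans (Real.exp_le_exp.mpr he1.le) hxee
  have hx1 : 1 < x := lt_of_lt_of_le (by linarith) hxe
  have hx0 : 0 < x := by linarith
  have hlogx : 1 ≤ Real.log x := by
    rw [← Real.log_exp 1]; exact Real.log_le_log (Real.exp_pos 1) hxe
  have hlogx0 : 0 < Real.log x := by linarith
  have hllx : 1 ≤ Real.log (Real.log x) := by
    rw [← Real.log_exp 1]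
    refine Real.log_le_log (Real.exp_pos 1) ?_
    rw [← Real.log_exp (Real.exp 1)]
    exact Real.log_le_log (Real.exp_pos _) hxee
  have hA0 : 0 ≤ A.size x := by rw [hhyp.size_eq]; exact A.congrSum_nonneg 1 x
  set Y : ℝ := fiY D θ x with hYdef
  obtain ⟨hY0, hYθ₁⟩ := fiY_pos_and_ge hx1.le hR1x.1 hθ₁13 (D := D)
  have hYe : Y ≤ e * Y := by nlinarith
  -- the splitting parameter `s`
  have hD0 : 0 < D x := lt_trans (Real.rpow_pos_of_pos hx0 _) hR1x.1
  have hSL : 1 ≤ fiSLow D α θ x := by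
    refine le_trans ?_ (fiSLow_ge hx1 hD0 hR1x.2)
    rw [one_le_div (by positivity)]
    exact hlog8x
  obtain ⟨s, hs, hs1⟩ := exists_isFISplit hSL
  obtain ⟨B, hB⟩ := A.exists_bound_fiS2_fiS3 (lam x) x
  -- integrability of `Φ(z) = (S♯(x, z) - H A(x)) / z`
  have hint := A.intervalIntegrable_fiTail_div x hY0 hYe
  have hinv : IntervalIntegrable (fun z : ℝ => z⁻¹) volume Y (e * Y) := by
    refine intervalIntegral.intervalIntegrable_inv (fun z hz => ?_) continuousOn_id
    rw [Set.uIcc_of_le hYe] at hz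
    exact (hY0.trans_le hz.1).ne'
  have hcI : IntervalIntegrable (fun z : ℝ => H * A.size x / z) volume Y (e * Y) := by
    simpa [div_eq_mul_inv] using hinv.const_mul (H * A.size x)
  have hΦ : IntervalIntegrable (fun z => (A.fiTail x z - H * A.size x) / z) volume Y (e * Y) := by
    have : (fun z => (A.fiTail x z - H * A.size x) / z) =
        fun z => A.fiTail x z / z - H * A.size x / z := by
      funext z; ring
    rw [this]
    exact hint.sub hcI
  -- the pointwise decomposition (3.4)
  have hid : ∀ y ∈ Icc Y (e * Y), ∀ z ∈ Icc Y (e * Y),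
      A.fiTail x z - H * A.size x = (A.fiT (lam x) x y - H * A.size x) - A.fiTyz (lam x) x y z
        + A.fiS1 (lam x) s x y z + A.fiS2 (lam x) s x y z + A.fiS3 (lam x) s x y z := by
    intro y hy z hz
    have := hhyp.fiTail_eq_decomposition hwx (x := x) (hY0.le.trans hy.1) (hY0.le.trans hz.1) hs1
      (hYθ₁.trans hz.1)
    rw [this]
    ring
  -- the averaged bound
  have key := abs_logAvg_le_of_decomposition (Y := Y) (Z := Y)
    (E₁ := KT * A.size x / Real.log x ^ 2) (E₂ := KTyz * A.size x / Real.log x ^ 2)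
    (E₃ := K1 * A.size x * Real.log (Real.log x) / Real.log x)
    (E₄ := K2 * A.size x / Real.log x) (E₅ := K3 * A.size x / Real.log x) (B := B)
    (Φ := fun z => A.fiTail x z - H * A.size x)
    (T₁ := fun y => A.fiT (lam x) x y - H * A.size x)
    (T₂ := fun y z => A.fiTyz (lam x) x y z) (P₁ := fun y z => A.fiS1 (lam x) s x y z)
    (P₂ := fun y z => A.fiS2 (lam x) s x y z) (P₃ := fun y z => A.fiS3 (lam x) s x y z)
    hY0 hY0 hΦ (A.measurable_fiS2 (lam x) s x) (A.measurable_fiS3 (lam x) s x)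
    (fun y _ z _ => (hB s y z).1) (fun y _ z _ => (hB s y z).2) hid
    (fun y hy => hTx y hy.1 hy.2) (fun y hy z hz => hTyzx y hy.1 hy.2 z hz.1 hz.2)
    (fun y hy z hz => h1x s hs y hy.1 hy.2 z hz.1 hz.2)
    (fun z hz => by simpa [SieveSequence.fiS2Y, SieveSequence.logAvg] using h2x s hs z hz.1 hz.2)
    (fun y hy => by simpa [SieveSequence.fiS3Z, SieveSequence.logAvg] using h3x s hs y hy.1 hy.2)
  -- `∫ (S♯ - HA)/z = S(x, Y) - H A(x)`
  have hone := integral_inv_Ioc_exp_mul hY0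
  have hsm : ∫ z in Y..(e * Y), (A.fiTail x z - H * A.size x) / z =
      A.fiSmooth x Y - H * A.size x := by
    have : (fun z => (A.fiTail x z - H * A.size x) / z) =
        fun z => A.fiTail x z / z - H * A.size x / z := by
      funext z; ring
    rw [this, intervalIntegral.integral_sub hint hcI]
    simp_rw [div_eq_mul_inv (H * A.size x)]
    rw [intervalIntegral.integral_const_mul, hone, mul_one]
    rfl
  rw [hsm] at key
  -- the small primes: `|S(x) - S(x, Y)| ≤ S(x) - S♯(x, eY) ≤ |K0| A(x)/log x`
  obtain ⟨hlo, hhi⟩ := A.fiTail_le_fiSmooth_le hY0 (x := x)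
  have hS : ∑ p ∈ Nat.primesLE ⌊x⌋₊, A.a p * Real.log p = A.fiTail x 0 := (hhyp.fiTail_zero x).symm
  have htail0 : A.fiTail x Y ≤ A.fiTail x 0 := A.fiTail_antitone x hY0.le
  have h0x' : A.fiTail x 0 - A.fiTail x (e * Y) ≤ |K0| * (A.size x / Real.log x) := by
    have h := h0x
    rw [hS, Real.norm_eq_abs, Real.norm_eq_abs, abs_of_nonneg (div_nonneg hA0 hlogx0.le)] at h
    calc A.fiTail x 0 - A.fiTail x (e * Y) ≤ |A.fiTail x 0 - A.fiTail x (e * Y)| := le_abs_self _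
      _ ≤ K0 * (A.size x / Real.log x) := h
      _ ≤ |K0| * (A.size x / Real.log x) :=
          mul_le_mul_of_nonneg_right (le_abs_self _) (div_nonneg hA0 hlogx0.le)
  have hpart1 : |A.fiTail x 0 - A.fiSmooth x Y| ≤ |K0| * (A.size x / Real.log x) := by
    rw [abs_of_nonneg (by linarith)]
    linarith
  -- combine
  rw [hS, Real.norm_eq_abs]
  have hmain : |A.fiTail x 0 - H * A.size x| ≤
      |K0| * (A.size x / Real.log x) +
      ((e - 1) ^ 2 * (KT * A.size x / Real.log x ^ 2 + KTyz * A.size x / Real.log x ^ 2 +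
          K1 * A.size x * Real.log (Real.log x) / Real.log x) +
        (e - 1) * (K2 * A.size x / Real.log x + K3 * A.size x / Real.log x)) := by
    calc |A.fiTail x 0 - H * A.size x|
        = |(A.fiTail x 0 - A.fiSmooth x Y) + (A.fiSmooth x Y - H * A.size x)| := by ring_nf
      _ ≤ |A.fiTail x 0 - A.fiSmooth x Y| + |A.fiSmooth x Y - H * A.size x| := abs_add_le _ _
      _ ≤ _ := add_le_add hpart1 key
  -- compare with `Ktot * A(x) log log x / log x`
  set L := Real.log x with hL
  set LL := Real.log (Real.log x) with hLL
  set Q : ℝ := A.size x * LL / L with hQ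
  have hQ0 : 0 ≤ Q := by positivity
  have hq1 : A.size x / L ≤ Q := by
    rw [hQ, div_le_div_iff_of_pos_right hlogx0]
    exact le_mul_of_one_le_right hA0 hllx
  have hq2 : A.size x / L ^ 2 ≤ Q :=
    le_trans (div_le_div_of_nonneg_left hA0 hlogx0 (by nlinarith)) hq1
  have hAL2 : 0 ≤ A.size x / L ^ 2 := by positivity
  have hAL : 0 ≤ A.size x / L := by positivity
  have t0 : |K0| * (A.size x / L) ≤ |K0| * Q := mul_le_mul_of_nonneg_left hq1 (abs_nonneg _)
  have t1 : KT * A.size x / L ^ 2 ≤ |KT| * Q := by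
    rw [mul_div_assoc]
    exact (mul_le_mul_of_nonneg_right (le_abs_self _) hAL2).trans
      (mul_le_mul_of_nonneg_left hq2 (abs_nonneg _))
  have t2 : KTyz * A.size x / L ^ 2 ≤ |KTyz| * Q := by
    rw [mul_div_assoc]
    exact (mul_le_mul_of_nonneg_right (le_abs_self _) hAL2).trans
      (mul_le_mul_of_nonneg_left hq2 (abs_nonneg _))
  have t3 : K1 * A.size x * LL / L ≤ |K1| * Q := by
    rw [show K1 * A.size x * LL / L = K1 * Q by rw [hQ]; ring]
    exact mul_le_mul_of_nonneg_right (le_abs_self _) hQ0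
  have t4 : K2 * A.size x / L ≤ |K2| * Q := by
    rw [mul_div_assoc]
    exact (mul_le_mul_of_nonneg_right (le_abs_self _) hAL).trans
      (mul_le_mul_of_nonneg_left hq1 (abs_nonneg _))
  have t5 : K3 * A.size x / L ≤ |K3| * Q := by
    rw [mul_div_assoc]
    exact (mul_le_mul_of_nonneg_right (le_abs_self _) hAL).trans
      (mul_le_mul_of_nonneg_left hq1 (abs_nonneg _))
  have he0 : 0 ≤ e - 1 := by linarith
  have u1 : (e - 1) ^ 2 * (KT * A.size x / L ^ 2 + KTyz * A.size x / L ^ 2 +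
      K1 * A.size x * LL / L) ≤ (e - 1) ^ 2 * ((|KT| + |KTyz| + |K1|) * Q) :=
    mul_le_mul_of_nonneg_left (by linarith) (sq_nonneg _)
  have u2 : (e - 1) * (K2 * A.size x / L + K3 * A.size x / L) ≤ (e - 1) * ((|K2| + |K3|) * Q) :=
    mul_le_mul_of_nonneg_left (by linarith) he0
  have hfin : |A.fiTail x 0 - H * A.size x| ≤ Ktot * Q := by
    refine hmain.trans ?_
    calc _ ≤ |K0| * Q + ((e - 1) ^ 2 * ((|KT| + |KTyz| + |K1|) * Q)
            + (e - 1) * ((|K2| + |K3|) * Q)) := add_le_add t0 (add_le_add u1 u2)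
      _ = Ktot * Q := by rw [hKtot]; ring
  refine hfin.trans (le_of_eq ?_)
  rw [Real.norm_of_nonneg (by positivity), hQ]
  field_simp

end Literature.NumberTheory.Sieve
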